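import Summits.Langlands.Langlands.Statement
import Literature.NumberTheory.GaloisRepresentations.CalegariEvenFontaineMazurTwo
import HarnessLib

/-!
# Witness (F3 / BC5) for the rung `ScalarSignRegularReciprocity 3` of line `ScalarSignRegularGL3`
# (crux `ReciprocityUpToIrreducibility`, item stmt-Langlands-14328; ladder generation 22)

The rung family `ScalarSignRegularReciprocity n` (VERBATIM the definition in
`Lines/ScalarSignRegularGL3.lean`) SPECIALISES at the floor parameter `n = 2` to the tree's named
Literature fact `Literature.NumberTheory.GaloisRepresentations.Calegari2011_thm_1_2`
(`Literature/NumberTheory/GaloisRepresentations/CalegariEvenFontaineMazurTwo.lean`; Calegari,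
*Even Galois representations and the Fontaine–Mazur conjecture. II*, JAMS 25 (2012), Thm. 1.2 —
a THEOREM IN PRINT, unproved in the tree, carried as the hypothesis of `floor_two`; NO `sorry`):
over a totally real `F` in which `p > 7` splits completely there is no continuous irreducible
`ρ : Γ_F → GL₂(ℚ̄_p)`, unramified a.e., de Rham with distinct Hodge–Tate weights at every `v ∣ p`
(pinned Fontaine datum), with `Sym² ρ̄|Γ_{F(ζ_p)}` absolutely irreducible and `ρ̄|Γ_{F_v}` (`v ∣ p`)
not a twist of `(1 *; 0 ε̄)`, which is EVEN at a real place.  The family's residual clause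
`ResidualNondegenerate F p 2 ρ` is Calegari's (2) ∧ (3) verbatim (pattern match on the rank), and its
sign clause `ρ(c) = 1 ∨ ρ(c) = -1` is `ρ.IsEven` at rank 2 (`FramedGaloisRep.isEven_iff_eq_one_or_eq_neg_one`),
so the family at `n = 2` holds VACUOUSLY — its hypotheses are contradictory by the floor fact — and
the (B)-form conclusion `∃ π, … Corresponds Rec ι π ρ` is never evaluated.
witness_regime: n = 2, F totally real, p > 7 split completely in F, ρ irreducible, de Rham regular,
residually Sym²-big, scalar sign (even).  S known there: clause (B) of S on exactly this cell IS the
floor fact (literal specialisation, vacuous sector); S as a whole is not known at n = 2 over totally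
real F (non-regular weights; p ≤ 7; residually small images: Calegari 2012 Rem. 1.3,
route `EvenVoidBelowEight`).
Calibration OUTSIDE S's known regime inside the rung n = 3: the potentially-Qian-ordinary cell
(`OrdinaryScalarSignGL3` of the line file) is decided in print (Qian 2022 Thm. 1.4 + Arthur–Clozel
descent + HLTT + Caraiani–Le Hung 2016 Thm. 1) while clause (B) for `GL₃` over totally real fields is open.
-/

noncomputable section

set_option linter.dupNamespace false

open scoped MatrixGroups Matrix NumberField Classical
open Filter IsDedekindDomain Field
open Literature.NumberTheory.Automorphic Literature.NumberTheory.GaloisRepresentations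
open Literature.NumberTheory.PAdicHodge
open Summit.Langlands

namespace Summit.Langlands.Langlands.Cruxes.ReciprocityUpToIrreducibility.ScalarSignRegularGL3.Special

/-! ## 1. The rung family (dial = rank `n`) -/

/-- **Residual non-degeneracy at rank `n`** — the rank-`n` reading of Calegari's hypotheses (2)–(3).
At `n = 2` VERBATIM Calegari 2011 Thm. 1.2 (2) `Sym² ρ̄|Γ_{F(ζ_p)}` absolutely irreducible and (3) for
`v ∣ p`, `ρ̄|D_v` is not a twist of `(ε̄ * ; 0 1)`; at every other rank: `ρ` has a residual representation
`ρ̄` (ACC⁺ §1) with `ρ̄|Γ_{F(ζ_p)}` absolutely irreducible (the Taylor–Wiles non-degeneracy of ACC⁺ Thm.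
6.1.1–6.1.2 / Qian 2022 Thm. 1.4, minus "enormous"/"decomposed generic", which the cells carry).
[cite: Calegari2011, Thm. 1.2] [cite: ACCGHLNSTT2023, Thm. 6.1.1] -/
def ResidualNondegenerate (F : Type) [Field F] [NumberField F] (p : ℕ) [Fact p.Prime] :
    (n : ℕ) → FramedGaloisRep F (PadicAlgCl p) n → Prop
  | 2, ρ =>
      IsAbsIrreducible
        ((Matrix.GeneralLinearGroup.symSq.comp ρ.residualRep).comp
          (modPCyclotomicCharacterZMod F p).ker.subtype) ∧
      ∀ (v : HeightOneSpectrum (𝓞 F)), ((p : ℕ) : 𝓞 F) ∈ v.asIdeal →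
        ¬ IsTwistOfExtOneBy
            (ρ.residualRep.comp (absGaloisRestrict F (v.adicCompletion F)).toMonoidHom)
            (fun g => zmodToPadicAlgClResidueField p ((modPCyclotomicCharacterZMod F p
              (absGaloisRestrict F (v.adicCompletion F) g) : (ZMod p)ˣ) : ZMod p))
  | _, ρ =>
      ∃ τ : absoluteGaloisGroup F →* GL (Fin _) (padicAlgClResidueField p),
        ρ.IsResidualRepOf (RingHom.id _) τ ∧
          IsAbsIrreducible (τ.comp (absGaloisGroupAdjoinRootsOfUnity F p).subtype)

/-- **The rung family** `ScalarSignRegularReciprocity n`: clause (B) of E, for EVERY reciprocity datum,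
on the scalar-sign regular sector of rank `n` over totally real fields (`p > 7` split completely in `F`,
`ρ` irreducible, a.e. unramified, de Rham with multiplicity-free labelled Hodge–Tate weights at every
`v ∣ p` for the pinned Fontaine datum, residually non-degenerate, `ρ(c) ∈ {1, -1}` for every complex
conjugation `c`).  Conjecturally vacuous for `n ≥ 2`; at `n = 2` it follows from Calegari's theorem
(`floor_two`). -/
def ScalarSignRegularReciprocity (n : ℕ) : Prop :=
  ∀ (F : Type) [Field F] [NumberField F], NumberField.IsTotallyReal F →
  ∀ (p : ℕ) [Fact p.Prime], 7 < p → SplitsCompletely F p →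
  ∀ (ρ : FramedGaloisRep F (PadicAlgCl p) n),
    ρ.toGaloisRep.IsIrreducible →
    (∀ᶠ v : HeightOneSpectrum (𝓞 F) in cofinite, ρ.IsUnramifiedAt v) →
    (∀ (v : HeightOneSpectrum (𝓞 F)) (hv : ((p : ℕ) : 𝓞 F) ∈ v.asIdeal),
      (fontainePstAdicCompletion v p hv).IsDeRhamFramed (ρ.toLocal v) ∧
        ∀ τ : v.adicCompletion F →+* PadicAlgCl p, Continuous τ →
          (ρ.labelledHodgeTateWeightsAt v (fontainePstAdicCompletion v p hv).algebra
            (fontainePstAdicCompletion v p hv).𝔅 τ).Nodup) →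
    ResidualNondegenerate F p n ρ →
    (∀ (φ : F →+* ℝ) (c : absoluteGaloisGroup F), IsComplexConjugation φ c → ρ c = 1 ∨ ρ c = -1) →
    ∀ (Rec : ReciprocityData F) (hcpt : isCompact_glFiniteIntegralLevel n F) (ι : PadicAlgCl p ≃+* ℂ),
      ∃ π : CuspidalAutomorphicRepData n F hcpt, π.1.IsLAlgebraic ∧ Corresponds Rec ι π.1 ρ

/-- **THE RUNG** (the filed statement): the family at `n = 3`. -/
def ScalarSignRegularGL3 : Prop := ScalarSignRegularReciprocity 3

/-! ## 2. The floor `n = 2` (Calegari 2011 Thm. 1.2) and the on-path lemmas -/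

/-- **The floor of the ladder**: the family at `n = 2` from the tree named fact `Calegari2011_thm_1_2`:
`ρ` is odd by the fact, even by the scalar-sign clause (`isEven_iff_eq_one_or_eq_neg_one`), and a totally
real field has a real embedding — contradiction (`Calegari2011_thm_1_2.not_isEven`).
[cite: Calegari2011, Thm. 1.2 (p. 3 of arXiv:1012.4819)] -/
theorem floor_two (h : Calegari2011_thm_1_2) : ScalarSignRegularReciprocity 2 := by
  intro F _ _ hF p _ hp hsplit ρ _hirr hur hpst hres hsign Rec hcpt ι
  exfalso
  haveI := hF
  obtain ⟨w⟩ := (inferInstance : Nonempty (NumberField.InfinitePlace F))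
  exact Calegari2011_thm_1_2.not_isEven h F hF
    (NumberField.InfinitePlace.embedding_of_isReal (NumberField.IsTotallyReal.isReal w)) p hp hsplit ρ
    hur hpst hres.1 hres.2 ((FramedGaloisRep.isEven_iff_eq_one_or_eq_neg_one two_ne_zero ρ).mpr hsign)

/-- **F3 instantiation, by name**: the family at the floor parameter from the named floor fact. -/
example (h : Calegari2011_thm_1_2) : ScalarSignRegularReciprocity 2 := floor_two h

end Summit.Langlands.Langlands.Cruxes.ReciprocityUpToIrreducibility.ScalarSignRegularGL3.Special

end
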